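import Summits.Schanuel.Schanuel.Theorems.SoloInformedAE1StructuredRoots

/-!
# Generic structured roots: an auxiliary pair `(Q, R)` small on most of a progression

Soloist file (informed mode, seat `solo-Schanuel-informed`, s180).  The generic form of Steps
0–3 of the seat's THEOREM AE-1 (`paper/AE-note.md` §7; tree file
`SoloInformedAE1StructuredRoots`, which is the special case `Q = R = P ∈ RoyAdditiveSmall`), as
needed by THEOREMS AE-1τ and AE-2 (`AE-note.md` §9): there `Q` is the primitive gcd of divided
derivatives (resp. of dilations) of Roy's polynomial — small at most points `cξ`, `1 ≤ c ≤ K`,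
by D. Roy's pointwise transfer [cite: Roy2010, Cor 3.2] — and `R` is its radical, a polynomial
of much smaller degree `≤ D₀` and Mahler measure `≤ exp L₀` vanishing at every root of `Q`
([cite: Roy2010, §1 p. 4, step (3)]).

`soloGS_structured_roots`: let `Q, R ∈ ℤ[X]` be non-zero, `deg Q ≤ n`, every complex root of
`Q` a root of `R`, `deg R ≤ D₀`, `log M(R) ≤ L₀`; let `E ⊆ ℕ` with `200·#E ≤ K` (`K ≥ 1000`)
and `|Q(cξ)| ≤ exp(-V)` for `c ∈ [1, K] ∖ E`; put `W = V K / (400 n)`, `ε = exp(-W)` and assume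
`exp(-c₁) ≤ min(1, ‖ξ‖/2)`, `2 c₁ n ≤ V`, `ε ≤ 1/2`, `4ε ≤ ‖ξ‖`, `log (8(K‖ξ‖ + 1)) ≤ W/2` and
the budget inequality `11000 (2 D₀³ L₀ + 2 D₀⁴) ≤ K³ · W/2`.  Then there are `S' ⊆ [1, K]`
with `#S' ≥ (49/50) K` and `γ, μ ∈ ℂ`, `μ ≠ 0`, with `R(γ + sμ) = 0` and `‖γ + sμ - sξ‖ ≤ ε`
for all `s ∈ S'`.

Chain (as in §7): `soloSS_servedSet_int` for `Q` on `[1, K] ∖ E` (radius parameter `200 n / K`)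
→ re-indexing of the served roots of `Q` as roots of `R` (injective on the served set because
two served points are `≥ ‖ξ‖` apart) → `soloAE_lemmaAE` for `R` (budget `soloGS_budget_le`) →
THEOREM C `soloAC_affine_off_sparse_of_few_violations`.

What this is NOT.  No small value estimate is proved here (the asymptotic bookkeeping and
Gel'fond's criterion come later) and nothing bears on `Literature.Periods.SchanuelConjecture`
(the seat's verdict, no path, is unchanged); the node [cite: Roy2010, Thm 1.1] is not claimed.
Tree files and Mathlib only; no definitions, no literature hypothesis; axioms the standard three.
-/

namespace Summit.Schanuel.Schanuel.Theorems

open Polynomial Finset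

/-- Two naturals whose multiples of `ξ` are both within `‖ξ‖/2` of one complex number are
equal. -/
theorem soloGS_eq_of_near {ξ z : ℂ} {a b : ℕ} (ha : ‖z - (a : ℂ) * ξ‖ < ‖ξ‖ / 2)
    (hb : ‖z - (b : ℂ) * ξ‖ < ‖ξ‖ / 2) : a = b := by
  by_contra hab
  have h3 : ‖(a : ℂ) * ξ - (b : ℂ) * ξ‖ < ‖ξ‖ := by
    calc ‖(a : ℂ) * ξ - (b : ℂ) * ξ‖ = ‖(z - (b : ℂ) * ξ) - (z - (a : ℂ) * ξ)‖ := by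
          congr 1; ring
      _ ≤ ‖z - (b : ℂ) * ξ‖ + ‖z - (a : ℂ) * ξ‖ := norm_sub_le _ _
      _ < ‖ξ‖ / 2 + ‖ξ‖ / 2 := add_lt_add hb ha
      _ = ‖ξ‖ := by ring
  have h4 : ‖ξ‖ ≤ ‖(a : ℂ) * ξ - (b : ℂ) * ξ‖ := by
    rw [← sub_mul, norm_mul]
    have hab' : (1 : ℝ) ≤ ‖((a : ℂ) - (b : ℂ))‖ := by
      have : ((a : ℂ) - (b : ℂ)) = ((a - b : ℤ) : ℂ) := by push_cast; ring
      rw [this, Complex.norm_intCast]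
      have hne : (a : ℤ) - b ≠ 0 := by omega
      exact_mod_cast Int.one_le_abs hne
    exact le_mul_of_one_le_left (norm_nonneg _) hab'
  linarith

/-- The right side of Lemma AE for `deg R = D ≤ D₀` and `0 ≤ L ≤ L₀`:
`2D(D-1)² · L + 5 C(D,2)² · log 2 ≤ 2 D₀³ L₀ + 2 D₀⁴`. -/
theorem soloGS_budget_le {D : ℕ} {D₀ L₀ L : ℝ} (hD : (D : ℝ) ≤ D₀) (hL0 : 0 ≤ L)
    (hL : L ≤ L₀) :
    ((2 * D * (D - 1) ^ 2 : ℕ) : ℝ) * L + ((5 * (D.choose 2) ^ 2 : ℕ) : ℝ) * Real.log 2 ≤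
      2 * D₀ ^ 3 * L₀ + 2 * D₀ ^ 4 := by
  have hDr : (0 : ℝ) ≤ D := Nat.cast_nonneg D
  have hD₀ : 0 ≤ D₀ := hDr.trans hD
  have h1 : ((2 * D * (D - 1) ^ 2 : ℕ) : ℝ) ≤ 2 * D₀ ^ 3 := by
    have h : 2 * D * (D - 1) ^ 2 ≤ 2 * D ^ 3 := by
      calc 2 * D * (D - 1) ^ 2 ≤ 2 * D * D ^ 2 :=
            Nat.mul_le_mul_left _ (Nat.pow_le_pow_left (Nat.sub_le D 1) 2)
        _ = 2 * D ^ 3 := by ring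
    have h' : ((2 * D * (D - 1) ^ 2 : ℕ) : ℝ) ≤ 2 * (D : ℝ) ^ 3 := by exact_mod_cast h
    exact h'.trans (by gcongr)
  have h2 : ((5 * (D.choose 2) ^ 2 : ℕ) : ℝ) * Real.log 2 ≤ 2 * D₀ ^ 4 := by
    have hc : D.choose 2 ≤ D ^ 2 / 2 := by
      rw [Nat.choose_two_right]
      exact Nat.div_le_div_right (by nlinarith [Nat.sub_le D 1])
    have hc2 : 4 * (5 * (D.choose 2) ^ 2) ≤ 5 * D ^ 4 := by
      have h3 : 2 * D.choose 2 ≤ D ^ 2 := by omega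
      calc 4 * (5 * (D.choose 2) ^ 2) = 5 * (2 * D.choose 2) ^ 2 := by ring
        _ ≤ 5 * (D ^ 2) ^ 2 := Nat.mul_le_mul_left 5 (Nat.pow_le_pow_left h3 2)
        _ = 5 * D ^ 4 := by ring
    have hc3 : 4 * ((5 * (D.choose 2) ^ 2 : ℕ) : ℝ) ≤ 5 * (D : ℝ) ^ 4 := by exact_mod_cast hc2
    have hlog2 : Real.log 2 ≤ 1 := by
      have := Real.log_two_lt_d9; norm_num at this; linarith
    have hlog0 : 0 ≤ Real.log 2 := Real.log_nonneg one_le_two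
    have h5 : (0 : ℝ) ≤ ((5 * (D.choose 2) ^ 2 : ℕ) : ℝ) := Nat.cast_nonneg _
    have hD4 : (D : ℝ) ^ 4 ≤ D₀ ^ 4 := by gcongr
    calc ((5 * (D.choose 2) ^ 2 : ℕ) : ℝ) * Real.log 2
        ≤ ((5 * (D.choose 2) ^ 2 : ℕ) : ℝ) * 1 := mul_le_mul_of_nonneg_left hlog2 h5
      _ ≤ 2 * D₀ ^ 4 := by nlinarith
  calc ((2 * D * (D - 1) ^ 2 : ℕ) : ℝ) * L + ((5 * (D.choose 2) ^ 2 : ℕ) : ℝ) * Real.log 2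
      ≤ 2 * D₀ ^ 3 * L₀ + 2 * D₀ ^ 4 :=
        add_le_add (mul_le_mul h1 hL hL0 (by positivity)) h2

/-- **Generic structured roots (AE-note §7 Steps 0–3 for an auxiliary pair `(Q, R)`).**  See
the module docstring for the statement in words; `W = V K / (400 n)`. -/
theorem soloGS_structured_roots {ξ : ℂ} {n K : ℕ} (hn : 1 ≤ n) (hK : 1000 ≤ K) {Q R : ℤ[X]}
    (hQ0 : Q ≠ 0) (hQdeg : Q.natDegree ≤ n) (hR0 : R ≠ 0)
    (hQR : ∀ z : ℂ, aeval z Q = 0 → aeval z R = 0) {D₀ L₀ : ℝ} (hD : (R.natDegree : ℝ) ≤ D₀)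
    (hL : Real.log (R.map (Int.castRingHom ℂ)).mahlerMeasure ≤ L₀) (E : Finset ℕ)
    (hE : 200 * #E ≤ K) {c₁ V : ℝ} (hc : Real.exp (-c₁) ≤ min 1 (‖ξ‖ / 2))
    (h₁ : 2 * c₁ * n ≤ V)
    (hsmall : ∀ c ∈ Icc 1 K \ E, ‖aeval ((c : ℂ) * ξ) Q‖ ≤ Real.exp (-V))
    (h₂ : Real.exp (-(V * K / (400 * n))) ≤ 1 / 2)
    (h₃ : 4 * Real.exp (-(V * K / (400 * n))) ≤ ‖ξ‖)
    (h₄ : Real.log (8 * (K * ‖ξ‖ + 1)) ≤ V * K / (800 * n))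
    (h₅ : 11000 * (2 * D₀ ^ 3 * L₀ + 2 * D₀ ^ 4) ≤ (K : ℝ) ^ 3 * (V * K / (800 * n))) :
    ∃ S' : Finset ℕ, S' ⊆ Icc 1 K ∧ (49 : ℝ) / 50 * K ≤ #S' ∧ ∃ γ μ : ℂ, μ ≠ 0 ∧
      ∀ s ∈ S', aeval (γ + (s : ℂ) * μ) R = 0 ∧
        ‖(γ + (s : ℂ) * μ) - (s : ℂ) * ξ‖ ≤ Real.exp (-(V * K / (400 * n))) := by
  classical
  obtain ⟨ρ, hρ⟩ := soloSI_exists_roots_enum (L := ℂ) Q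
  obtain ⟨ρR, hρR⟩ := soloSI_exists_roots_enum (L := ℂ) R
  have hn0 : (0 : ℝ) < n := by exact_mod_cast hn
  have hK0 : (0 : ℝ) < K := by exact_mod_cast (show 0 < K by omega)
  set W : ℝ := V * K / (400 * n) with hW
  have hW2 : V * K / (800 * n) = W / 2 := by rw [hW]; ring
  rw [hW2] at h₄ h₅
  set ε : ℝ := Real.exp (-W) with hε
  have hε0 : 0 < ε := Real.exp_pos _
  have hW0 : 0 < W := by
    by_contra h
    have h1 : (1 : ℝ) ≤ Real.exp (-W) := Real.one_le_exp (by linarith)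
    linarith
  have hV0 : 0 < V := by
    have h : W * (400 * n) = V * K := by rw [hW]; field_simp
    by_contra hV
    have h1 : V * K ≤ 0 := mul_nonpos_of_nonpos_of_nonneg (not_lt.mp hV) hK0.le
    nlinarith [mul_pos hW0 (by positivity : (0 : ℝ) < 400 * n)]
  have hR' : R.map (Int.castRingHom ℂ) ≠ 0 :=
    (Polynomial.map_ne_zero_iff Int.cast_injective).mpr hR0
  -- Step 0: `Q` has positive degree (it is small at some point of the progression)
  have hCne : (Icc 1 K \ E).Nonempty := by
    rw [← Finset.card_pos]
    have h1 : #(Icc 1 K) - #E ≤ #(Icc 1 K \ E) := Finset.le_card_sdiff E (Icc 1 K)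
    rw [Nat.card_Icc] at h1
    omega
  have hDQ : 0 < Q.natDegree := by
    obtain ⟨c, hc'⟩ := hCne
    by_contra h
    have h0 : Q.natDegree = 0 := by omega
    have hv := hsmall c hc'
    rw [eq_C_of_natDegree_eq_zero h0, aeval_C, algebraMap_int_eq, eq_intCast,
      Complex.norm_intCast] at hv
    have hc0 : Q.coeff 0 ≠ 0 := by
      intro hq
      apply hQ0
      rw [eq_C_of_natDegree_eq_zero h0, hq, C_0]
    have h1' : (1 : ℝ) ≤ |((Q.coeff 0 : ℤ) : ℝ)| := by exact_mod_cast Int.one_le_abs hc0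
    have h2' : Real.exp (-V) < 1 := Real.exp_lt_one_iff.mpr (by linarith)
    linarith
  -- Step 1: the served set for `Q` on `[1, K] ∖ E`, radius parameter `200 n / K`
  have hc₁0 : 0 ≤ c₁ := by
    have h := (le_min_iff.mp hc).1
    have := Real.exp_le_one_iff.mp h
    linarith
  have hVc : c₁ * n < V := by
    rcases (mul_nonneg hc₁0 hn0.le).eq_or_lt with h | h
    · rw [← h]; exact hV0
    · linarith
  have hsmall' : ∀ c ∈ Icc 1 K \ E,
      ‖(Q.map (Int.castRingHom ℂ)).eval ((c : ℂ) * ξ + 0)‖ ≤ Real.exp (-V) := by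
    intro c hc'
    rw [add_zero, eval_map_intCastRingHom]
    exact hsmall c hc'
  obtain ⟨S, hSC, ιQ, hcardt, -, hnear, hfar⟩ :=
    soloSS_servedSet_int (N := n) Q hQ0 ρ hρ hDQ hQdeg ξ 0 (Icc 1 K \ E) (200 * n / K) hc hVc
      hsmall'
  have hrad : Real.exp (-(V - c₁ * n) / (200 * n / K)) ≤ ε := by
    rw [hε, Real.exp_le_exp, neg_div, neg_le_neg_iff, le_div_iff₀ (by positivity)]
    have : W * (200 * n / K) = V / 2 := by
      rw [hW]; field_simp; ring
    rw [this]
    linarith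
  -- re-index the served roots of `Q` as roots of `R`
  have hex : ∀ c : ℕ, ∃ k : Fin R.natDegree, ρR k = ρ (ιQ c) := by
    intro c
    have hz : aeval (ρ (ιQ c)) R = 0 := hQR _ (soloSR_aeval_enum_eq_zero Q hQ0 ρ hρ (ιQ c))
    have hmem : ρ (ιQ c) ∈ (R.map (Int.castRingHom ℂ)).roots := by
      rw [mem_roots hR', IsRoot.def, eval_map_intCastRingHom]
      exact hz
    rw [← hρR, Multiset.mem_map] at hmem
    obtain ⟨k, -, hk⟩ := hmem
    exact ⟨k, hk⟩
  choose ι hι using hex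
  have hnear' : ∀ s ∈ S, ‖ρR (ι s) - (s : ℂ) * ξ‖ < ‖ξ‖ / 2 := by
    intro s hs
    have h := hnear s hs
    rwa [add_zero, ← hι s] at h
  have hιS : Set.InjOn ι S := by
    intro a ha b hb hab
    have h1 := hnear' a ha
    have h2 := hnear' b hb
    rw [hab] at h1
    exact soloGS_eq_of_near h1 h2
  have hservedε : ∀ s ∈ S, ‖ρR (ι s) - (s * ξ + 0)‖ ≤ ε := by
    intro s hs
    rw [hι s]
    exact (hfar s hs).trans hrad
  have hSI : S ⊆ Icc 1 K := fun s hs => (Finset.mem_sdiff.mp (hSC hs)).1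
  have hSK : ∀ s ∈ S, s ≤ K := fun s hs => (Finset.mem_Icc.mp (hSI hs)).2
  have hE' : 100 * #(Icc 1 K \ S) ≤ K := by
    have h : (#((Icc 1 K \ E) \ S) : ℝ) * (200 * n / K) ≤ n := hcardt
    rw [← mul_div_assoc, div_le_iff₀ hK0] at h
    have h3 : (200 * (#((Icc 1 K \ E) \ S) : ℝ)) * n ≤ K * n := by linarith
    have h4 := le_of_mul_le_mul_right h3 hn0
    have h5 : 200 * #((Icc 1 K \ E) \ S) ≤ K := by exact_mod_cast h4
    have h6 : Icc 1 K \ S ⊆ E ∪ ((Icc 1 K \ E) \ S) := by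
      intro x hx
      rw [Finset.mem_union, Finset.mem_sdiff, Finset.mem_sdiff]
      rw [Finset.mem_sdiff] at hx
      by_cases hxE : x ∈ E
      · exact Or.inl hxE
      · exact Or.inr ⟨⟨hx.1, hxE⟩, hx.2⟩
    have h7 := (Finset.card_le_card h6).trans (Finset.card_union_le _ _)
    omega
  -- Step 2: violations of exact additivity inject into inexact coincidences (Lemma AE for `R`)
  set Vset : Finset ((ℕ × ℕ) × ℕ) := ((S ×ˢ S) ×ˢ Finset.range (K + 1)).filter
    (fun x => x.1.1 + x.2 ∈ S ∧ x.1.2 + x.2 ∈ S ∧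
      ρR (ι (x.1.1 + x.2)) - ρR (ι x.1.1) ≠ ρR (ι (x.1.2 + x.2)) - ρR (ι x.1.2)) with hVset
  have hVmem : ∀ a ∈ S, ∀ b ∈ S, ∀ u : ℕ, a + u ∈ S → b + u ∈ S →
      (fun s => ρR (ι s)) (a + u) - (fun s => ρR (ι s)) a ≠
        (fun s => ρR (ι s)) (b + u) - (fun s => ρR (ι s)) b → ((a, b), u) ∈ Vset := by
    intro a ha b hb u hau hbu hne
    rw [hVset, Finset.mem_filter]
    refine ⟨?_, hau, hbu, hne⟩
    simp only [Finset.mem_product, Finset.mem_range]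
    exact ⟨⟨ha, hb⟩, by have := hSK _ hau; omega⟩
  have hVset_mem : ∀ x ∈ Vset, x.1.1 ∈ S ∧ x.1.2 ∈ S ∧ x.1.1 + x.2 ∈ S ∧ x.1.2 + x.2 ∈ S ∧
      ρR (ι (x.1.1 + x.2)) - ρR (ι x.1.1) ≠ ρR (ι (x.1.2 + x.2)) - ρR (ι x.1.2) ∧ 0 < x.2 := by
    intro x hx
    rw [hVset, Finset.mem_filter, Finset.mem_product, Finset.mem_product] at hx
    obtain ⟨⟨⟨ha, hb⟩, -⟩, hau, hbu, hne⟩ := hx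
    refine ⟨ha, hb, hau, hbu, hne, Nat.pos_of_ne_zero ?_⟩
    intro hu
    apply hne
    rw [hu, add_zero, add_zero, sub_self, sub_self]
  have hginj : Function.Injective
      (fun x : (ℕ × ℕ) × ℕ => ((x.1.1 + x.2, x.1.1), (x.1.2 + x.2, x.1.2))) := by
    rintro ⟨⟨a, b⟩, u⟩ ⟨⟨a', b'⟩, u'⟩ h
    simp only [Prod.mk.injEq] at h
    obtain ⟨⟨h1, h2⟩, h3, h4⟩ := h
    subst h2
    subst h4
    have hu : u = u' := by omega
    subst hu
    rfl
  set 𝒞 := Vset.image (fun x : (ℕ × ℕ) × ℕ => ((x.1.1 + x.2, x.1.1), (x.1.2 + x.2, x.1.2)))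
    with h𝒞
  have hC𝒞 : #𝒞 = #Vset := Finset.card_image_of_injective _ hginj
  have hAE := soloAE_lemmaAE R hR0 rfl ρR hρR ξ 0 K hε0 h₂ h₃ S hSK ι hιS hservedε 𝒞
    (fun c hc => by
      obtain ⟨x, hx, rfl⟩ := Finset.mem_image.mp hc
      obtain ⟨ha, hb, hau, hbu, -, -⟩ := hVset_mem x hx
      exact ⟨hau, ha, hbu, hb⟩)
    (fun c hc => by
      obtain ⟨x, hx, rfl⟩ := Finset.mem_image.mp hc
      obtain ⟨-, -, -, -, -, hu⟩ := hVset_mem x hx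
      exact ⟨by simp only; omega, by simp only; omega⟩)
    (fun c hc => by
      obtain ⟨x, hx, rfl⟩ := Finset.mem_image.mp hc
      simp only; ring)
    (fun c hc => by
      obtain ⟨x, hx, rfl⟩ := Finset.mem_image.mp hc
      obtain ⟨-, -, -, -, hne, -⟩ := hVset_mem x hx
      exact hne)
  -- the numerical budget: `#Vset · W/2 ≤ 2 D₀³ L₀ + 2 D₀⁴`
  have hL' : W / 2 ≤ Real.log (1 / (8 * (K * ‖ξ‖ + 1) * ε)) := by
    rw [one_div, Real.log_inv, hε, Real.log_mul (by positivity) (Real.exp_pos _).ne',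
      Real.log_exp]
    linarith
  have hlogM0 : 0 ≤ Real.log (R.map (Int.castRingHom ℂ)).mahlerMeasure :=
    Real.log_nonneg (Polynomial.one_le_mahlerMeasure_of_ne_zero hR0)
  have hB := soloGS_budget_le hD hlogM0 hL
  have hD₀ : 0 ≤ D₀ := (Nat.cast_nonneg _).trans hD
  have hL₀ : 0 ≤ L₀ := hlogM0.trans hL
  have hB0 : 0 ≤ 2 * D₀ ^ 3 * L₀ + 2 * D₀ ^ 4 := by positivity
  have hVcard : (#Vset : ℝ) * (W / 2) ≤ 2 * D₀ ^ 3 * L₀ + 2 * D₀ ^ 4 := by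
    rw [← hC𝒞]
    calc (#𝒞 : ℝ) * (W / 2) ≤ #𝒞 * Real.log (1 / (8 * (K * ‖ξ‖ + 1) * ε)) :=
          mul_le_mul_of_nonneg_left hL' (Nat.cast_nonneg _)
      _ ≤ _ := hAE
      _ ≤ 2 * D₀ ^ 3 * L₀ + 2 * D₀ ^ 4 := hB
  have hVK : 10000 * #Vset ≤ K ^ 3 := by
    have key : (10000 * #Vset : ℝ) * (W / 2) ≤ (K : ℝ) ^ 3 * (W / 2) := by
      calc (10000 * #Vset : ℝ) * (W / 2) = 10000 * ((#Vset : ℝ) * (W / 2)) := by ring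
        _ ≤ 10000 * (2 * D₀ ^ 3 * L₀ + 2 * D₀ ^ 4) :=
            mul_le_mul_of_nonneg_left hVcard (by norm_num)
        _ ≤ (K : ℝ) ^ 3 * (W / 2) := by linarith
    have h := le_of_mul_le_mul_right key (half_pos hW0)
    exact_mod_cast h
  -- Step 3: THEOREM C
  obtain ⟨γ, μ, X, hXcard, haff⟩ :=
    soloAC_affine_off_sparse_of_few_violations hK hSI hE' (fun s => ρR (ι s)) hVmem hVK
  have haff' : ∀ s ∈ S, s ∉ X → ρR (ι s) = γ + (s : ℂ) * μ := by
    intro s hs hX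
    have h := haff s hs hX
    simp only [nsmul_eq_mul] at h
    exact h
  have hXreal : (100 * #X : ℝ) ≤ K := by
    have h1 : ((K : ℝ) ^ 2 * #X) ≤ 110 * #Vset := by exact_mod_cast hXcard
    have key : (100 * #X : ℝ) * ((K : ℝ) ^ 2 * (W / 2)) ≤
        (K : ℝ) * ((K : ℝ) ^ 2 * (W / 2)) := by
      calc (100 * #X : ℝ) * ((K : ℝ) ^ 2 * (W / 2))
          = 100 * (((K : ℝ) ^ 2 * #X) * (W / 2)) := by ring
        _ ≤ 100 * ((110 * #Vset) * (W / 2)) := by gcongr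
        _ = 11000 * ((#Vset : ℝ) * (W / 2)) := by ring
        _ ≤ 11000 * (2 * D₀ ^ 3 * L₀ + 2 * D₀ ^ 4) :=
            mul_le_mul_of_nonneg_left hVcard (by norm_num)
        _ ≤ (K : ℝ) ^ 3 * (W / 2) := h₅
        _ = (K : ℝ) * ((K : ℝ) ^ 2 * (W / 2)) := by ring
    exact le_of_mul_le_mul_right key (by positivity)
  -- Step 4: the structured set `S' = S \ X`
  set S' := S.filter (fun s => s ∉ X) with hS'
  have hS'card : (49 : ℝ) / 50 * K ≤ #S' := by
    have e1 : (#(Icc 1 K \ S) : ℝ) + #S = K := by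
      have h := Finset.card_sdiff_add_card_eq_card hSI
      rw [Nat.card_Icc] at h
      have h' : #(Icc 1 K \ S) + #S = K := by omega
      exact_mod_cast h'
    have e2 : (#(S.filter (fun s => s ∈ X)) : ℝ) + #S' = #S := by
      exact_mod_cast Finset.card_filter_add_card_filter_not (fun s => s ∈ X)
    have e3 : (#(S.filter (fun s => s ∈ X)) : ℝ) ≤ #X := by
      exact_mod_cast Finset.card_le_card (fun s hs => (Finset.mem_filter.mp hs).2)
    have e4 : (100 * #(Icc 1 K \ S) : ℝ) ≤ K := by exact_mod_cast hE'
    linarith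
  have hμ : μ ≠ 0 := by
    intro hμ
    have hK' : (1000 : ℝ) ≤ K := by exact_mod_cast hK
    have h980 : (980 : ℝ) ≤ #S' := by linarith
    have hcard' : 1 < #S' := by
      have : (980 : ℕ) ≤ #S' := by exact_mod_cast h980
      omega
    obtain ⟨a, ha, b, hb, hab⟩ := Finset.one_lt_card.mp hcard'
    have ha' := Finset.mem_filter.mp ha
    have hb' := Finset.mem_filter.mp hb
    have hφa : ρR (ι a) = γ + (a : ℂ) * μ := haff' a ha'.1 ha'.2
    have hφb : ρR (ι b) = γ + (b : ℂ) * μ := haff' b hb'.1 hb'.2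
    rw [hμ, mul_zero, add_zero] at hφa hφb
    have h1 := hnear' a ha'.1
    have h2 := hnear' b hb'.1
    rw [hφa] at h1
    rw [hφb] at h2
    exact hab (soloGS_eq_of_near h1 h2)
  refine ⟨S', fun s hs => hSI (Finset.mem_filter.mp hs).1, hS'card, γ, μ, hμ, ?_⟩
  intro s hs
  obtain ⟨hsS, hsX⟩ := Finset.mem_filter.mp hs
  have hφs : ρR (ι s) = γ + (s : ℂ) * μ := haff' s hsS hsX
  refine ⟨?_, ?_⟩
  · rw [← hφs]; exact soloSR_aeval_enum_eq_zero R hR0 ρR hρR (ι s)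
  · rw [← hφs]
    have h := hservedε s hsS
    rwa [add_zero] at h

end Summit.Schanuel.Schanuel.Theorems
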